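import Summits.CriticalPhenomena.PercolationContinuityZ3.Theorems.PercNearOneGluingNoHeavyQuantCrossingWindowOneArm
import Summits.CriticalPhenomena.PercolationContinuityZ3.Theorems.PercNearOneGluingNoHeavyQuantPowerLawInputs
import HarnessLib

/-!
# Admissibility of the pair ((T1)_c, subcritical arm decay with exponent ν): `ν·(d − c) ≥ 2` — Dewan–Muirhead's
# `η̄₁ ≤ d − 2/ν` as a kernel constraint between the lane's two typed conjectural inputs

builds on p205010 (kernel theorem, internal audit signed; external expert review pending) — NOT used in this file.

QUANT lane (`prim-quant`), seat p4 (METHOD: differential inequalities for `θ` near `p_c`), gen 14; helper file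
`--supports stmt-CriticalPhenomena-4575`; pure proofs, no definitions, no sorries.

V. Dewan, S. Muirhead, PTRF (2022), Thm. 1.10: for Bernoulli percolation on `ℤ^d`, assuming the exponents exist,
`η̄₁ ≤ d − 2/ν`.  Here the two exponents are carried by the lane's typed predicates
`Quant.OneArmPolyDecayAtCritical d c C` (`π_{p_c}(n) ≤ C n^{−c}`, the (T1) shape; `…QuantOneArm.lean`) and
`Quant.SubcriticalArmDecay d A ν δ₀` (`π_q(n) ≤ A n^{d−1} exp(−(p_c − q)^ν n/A)` for `q ∈ (p_c − δ₀, p_c)`; arm-3's C2-input,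
`…QuantPowerLawInputs.lean`), and the theorem is their JOINT ADMISSIBILITY:

* `two_le_nu_mul_of_subcriticalArmDecay_of_oneArmDecay` — **`SubcriticalArmDecay d A ν δ₀ ∧ OneArmPolyDecayAtCritical d c C
  ⟹ 2 ≤ ν·(d − c)`** (`d ≥ 2`, `0 < ν`, `0 < A`, `0 < δ₀`); equivalently `oneArm_exponent_le_of_subcriticalArmDecay`:
  **`c ≤ d − 2/ν`**.

Proof (the one-arm window `…QuantCrossingWindowOneArm.lean` at the scale dictated by the arm decay): with
`s_L^ν = A·d·log L / L` the subcritical one-arm at `q_L = p_c − s_L` satisfies `π_{q_L}(3L−1) ≤ A(3L−1)^{d−1}L^{−2d}`, so the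
annulus `Λ(L) ↔ ∂Λ(4L)` is crossed with probability `≤ (2L+1)^d·π_{q_L}(3L−1) → 0` (`Rsw3.real_boxCrossing_le_card_mul_oneArmProb`);
the window contrapositive then forces `85^{−d}q_L(1−p_c) < s_L²·16d(8L+1)^d·θ_L(p_c) ≤ K·(log L)^{2/ν}·L^{d − c − 2/ν}`, which tends
to `0` unless `d − c − 2/ν ≥ 0`.  Companion rows: arm-3's `Quant.oneArmPolyDecayAtCritical_of_subcriticalArmDecay` (the same
`ν`-input with a `γ`-input GIVES (T1) with `c < (2−γ)/ν`) and p4 g12's `two_rho_div_delta_le_nu_of_subcriticalArmDecay`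
(`ν ≥ 2ρ/δ`).  Honest: both predicates are OPEN for `3 ≤ d ≤ 6`; mean field (`c = 2`, `ν = 1/2`, `d = 6`) is the equality
case; `d = 3` with `c ≈ 0.48` (orientation only): admissible `ν ≥ 0.79` (true `≈ 0.88`); with the tree's ceiling `c ≤ 1`
(`Quant.oneArmPolyDecayAtCritical_exponent_le`) every admissible `ν` on `ℤ³` is `≥ 2/3` = CCFS.
[cite: DewanMuirhead2022, Thm. 1.10 (η̄₁ ≤ d − 2/ν) and its proof §2 p. 10]
-/

noncomputable section

namespace Summit.CriticalPhenomena.PercolationContinuityZ3.Theorems.CrossingRevealment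

open MeasureTheory Finset Function Set Filter Topology Asymptotics
open Literature.Probability.Percolation Literature.Probability.LatticeModels
open Literature.Probability.Percolation.DCT16
open Summit.CriticalPhenomena.PercolationContinuityZ3.Theorems.SurfaceTension
open Summit.CriticalPhenomena.PercolationContinuityZ3.Theorems.Crossing

variable {d : ℕ}

/-- `(log x)^a ≤ ε^{−a} x^{aε}` for `x ≥ 1`, `a ≥ 0`, `ε > 0` (from `log x ≤ x^ε/ε`). [folklore] -/
private theorem log_rpow_le' (a ε : ℝ) (ha : 0 ≤ a) (hε : 0 < ε) {x : ℝ} (hx : 1 ≤ x) :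
    Real.log x ^ a ≤ ε⁻¹ ^ a * x ^ (a * ε) := by
  have hx0 : 0 ≤ x := by linarith
  have hlog0 : 0 ≤ Real.log x := Real.log_nonneg hx
  have h := Real.log_le_rpow_div hx0 hε
  calc Real.log x ^ a ≤ (x ^ ε / ε) ^ a := Real.rpow_le_rpow hlog0 h ha
    _ = ε⁻¹ ^ a * x ^ (a * ε) := by
        rw [div_eq_mul_inv, Real.mul_rpow (Real.rpow_nonneg hx0 _) (by positivity), ← Real.rpow_mul hx0,
          mul_comm ε a, mul_comm]

/-- `L^{e}·(log L)^{b} → 0` as `L → ∞` for `e < 0 ≤ b`. [folklore] -/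
private theorem tendsto_rpow_mul_log_rpow {e b : ℝ} (he : e < 0) (hb : 0 ≤ b) :
    Tendsto (fun L : ℕ => (L : ℝ) ^ e * Real.log L ^ b) atTop (𝓝 0) := by
  -- `(log L)^b ≤ ε^{-b} L^{bε}` with `bε ≤ -e/2`
  obtain ⟨ε, hε, hbε⟩ : ∃ ε : ℝ, 0 < ε ∧ b * ε ≤ -e / 2 := by
    by_cases hb0 : b = 0
    · exact ⟨1, one_pos, by rw [hb0]; linarith⟩
    · have hb' : 0 < b := lt_of_le_of_ne hb (Ne.symm hb0)
      refine ⟨(-e / 2) / b, div_pos (by linarith) hb', ?_⟩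
      rw [mul_div_cancel₀ _ hb'.ne']
  have hlim : Tendsto (fun L : ℕ => ε⁻¹ ^ b * (L : ℝ) ^ (e / 2)) atTop (𝓝 0) := by
    have h1 : Tendsto (fun x : ℝ => x ^ (e / 2)) atTop (𝓝 0) := by
      have := tendsto_rpow_neg_atTop (y := -(e / 2)) (by linarith)
      simpa using this
    have h2 := (h1.comp tendsto_natCast_atTop_atTop).const_mul (ε⁻¹ ^ b)
    rw [mul_zero] at h2
    exact h2
  refine squeeze_zero_norm' ?_ hlim
  filter_upwards [eventually_ge_atTop 1] with L hL
  have hL' : (1 : ℝ) ≤ L := by exact_mod_cast hL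
  have hL0 : (0 : ℝ) < L := by linarith
  rw [Real.norm_eq_abs, abs_of_nonneg (mul_nonneg (Real.rpow_nonneg hL0.le _)
    (Real.rpow_nonneg (Real.log_nonneg hL') _))]
  calc (L : ℝ) ^ e * Real.log L ^ b ≤ (L : ℝ) ^ e * (ε⁻¹ ^ b * (L : ℝ) ^ (b * ε)) :=
        mul_le_mul_of_nonneg_left (log_rpow_le' b ε hb hε hL') (Real.rpow_nonneg hL0.le _)
    _ = ε⁻¹ ^ b * (L : ℝ) ^ (e + b * ε) := by rw [Real.rpow_add hL0]; ring
    _ ≤ ε⁻¹ ^ b * (L : ℝ) ^ (e / 2) := by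
        refine mul_le_mul_of_nonneg_left (Real.rpow_le_rpow_of_exponent_le hL' (by linarith)) (by positivity)

/-- **ADMISSIBILITY: `SubcriticalArmDecay d A ν δ₀ ∧ OneArmPolyDecayAtCritical d c C ⟹ 2 ≤ ν·(d − c)`** (`d ≥ 2`,
`0 < ν, A, δ₀`) — Dewan–Muirhead's `η̄₁ ≤ d − 2/ν` as a kernel constraint between the lane's typed subcritical correlation-length
input and the (T1) shape.  [cite: DewanMuirhead2022, Thm. 1.10 (η̄₁ ≤ d − 2/ν)] -/
theorem two_le_nu_mul_of_subcriticalArmDecay_of_oneArmDecay (hd : 2 ≤ d) {A ν δ₀ c C : ℝ} (hν : 0 < ν)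
    (hA : 0 < A) (hδ₀ : 0 < δ₀) (harm : Quant.SubcriticalArmDecay d A ν δ₀)
    (hdec : Quant.OneArmPolyDecayAtCritical d c C) : 2 ≤ ν * (d - c) := by
  by_contra hcon
  push Not at hcon
  have hd0 : 0 < d := by omega
  have hd' : (0 : ℝ) < d := by exact_mod_cast hd0
  have hpc0 : 0 < (criticalProbI d : ℝ) := (FiniteSizeSharpness.criticalProbI_mem_Ioo hd).1
  have hpc1 : (criticalProbI d : ℝ) < 1 := (FiniteSizeSharpness.criticalProbI_mem_Ioo hd).2
  -- the exponent `e = d − c − 2/ν < 0`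
  set e : ℝ := (d : ℝ) - c - 2 / ν with he
  have he0 : e < 0 := by
    have : ν * ((d : ℝ) - c) < 2 := hcon
    have h1 : (d : ℝ) - c < 2 / ν := by rw [lt_div_iff₀ hν]; linarith
    rw [he]; linarith
  have hC0 : 0 ≤ C := by
    have h1 := hdec 1 le_rfl
    simp only [Nat.cast_one, Real.one_rpow, mul_one] at h1
    exact measureReal_nonneg.trans h1
  -- the scale parameters `t_L = A d log L / L`, `s_L = t_L^{1/ν}`
  set t : ℕ → ℝ := fun L => A * d * Real.log L / L with ht
  set s : ℕ → ℝ := fun L => t L ^ (1 / ν) with hs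
  have ht0 : ∀ L : ℕ, 1 ≤ L → 0 ≤ t L := by
    intro L hL
    have : (1 : ℝ) ≤ L := by exact_mod_cast hL
    exact div_nonneg (mul_nonneg (by positivity) (Real.log_nonneg this)) (by positivity)
  have hs0 : ∀ L : ℕ, 1 ≤ L → 0 ≤ s L := fun L hL => Real.rpow_nonneg (ht0 L hL) _
  have hsν : ∀ L : ℕ, 1 ≤ L → s L ^ ν = t L := by
    intro L hL
    rw [hs]; dsimp only
    rw [← Real.rpow_mul (ht0 L hL), one_div_mul_cancel hν.ne', Real.rpow_one]
  -- `t_L → 0`, hence `s_L → 0`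
  have ht_lim : Tendsto t atTop (𝓝 0) := by
    have h1 : Tendsto (fun x : ℝ => Real.log x / x) atTop (𝓝 0) :=
      Real.isLittleO_log_id_atTop.tendsto_div_nhds_zero
    have h2 := ((h1.comp tendsto_natCast_atTop_atTop).const_mul (A * d))
    rw [mul_zero] at h2
    refine h2.congr fun L => ?_
    simp only [ht, Function.comp]; ring
  have hs_lim : Tendsto s atTop (𝓝 0) := by
    have h := ht_lim.rpow_const (p := 1 / ν) (Or.inr (by positivity))
    rwa [Real.zero_rpow (by positivity)] at h
  -- the right side of the window inequality tends to `0`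
  set K : ℝ := 16 * d * (9 : ℝ) ^ d * C * (A * d) ^ (2 / ν) with hK
  have hK0 : 0 ≤ K := by positivity
  have hrhs_lim : Tendsto (fun L : ℕ => K * ((L : ℝ) ^ e * Real.log L ^ (2 / ν))) atTop (𝓝 0) := by
    have h := (tendsto_rpow_mul_log_rpow he0 (by positivity : (0 : ℝ) ≤ 2 / ν)).const_mul K
    rwa [mul_zero] at h
  -- the subcritical envelope tends to `0`
  have henv_lim : Tendsto (fun L : ℕ => A * (3 : ℝ) ^ (2 * d - 1) / L) atTop (𝓝 0) :=
    tendsto_const_nhds.div_atTop tendsto_natCast_atTop_atTop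
  -- collect the eventual conditions
  set c85 : ℝ := ((85 : ℝ) ^ d)⁻¹ with hc85
  have hc85pos : 0 < c85 := by positivity
  have hLHS : 0 < c85 * (criticalProbI d / 2) * (1 - criticalProbI d) := by
    have : 0 < 1 - (criticalProbI d : ℝ) := by linarith
    positivity
  have ev1 : ∀ᶠ L : ℕ in atTop, s L < min δ₀ (criticalProbI d / 2) :=
    hs_lim (Iio_mem_nhds (lt_min hδ₀ (by linarith)))
  have ev2 : ∀ᶠ L : ℕ in atTop, A * (3 : ℝ) ^ (2 * d - 1) / L < c85 / 4 :=
    henv_lim (Iio_mem_nhds (by positivity))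
  have ev3 : ∀ᶠ L : ℕ in atTop, K * ((L : ℝ) ^ e * Real.log L ^ (2 / ν))
      < c85 * (criticalProbI d / 2) * (1 - criticalProbI d) := hrhs_lim (Iio_mem_nhds hLHS)
  obtain ⟨L, hL1, h1, h2, h3⟩ := ((eventually_ge_atTop 2).and (ev1.and (ev2.and ev3))).exists
  -- facts at the scale `L`
  have hL1' : 1 ≤ L := by omega
  have hLr : (2 : ℝ) ≤ L := by exact_mod_cast hL1
  have hLpos : (0 : ℝ) < L := by linarith
  have hsL0 : 0 ≤ s L := hs0 L hL1'
  have hsδ : s L < δ₀ := lt_of_lt_of_le h1 (min_le_left _ _)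
  have hspc : s L < criticalProbI d / 2 := lt_of_lt_of_le h1 (min_le_right _ _)
  -- the parameter `q_L = p_c − s_L`
  set qr : ℝ := (criticalProbI d : ℝ) - s L with hqr
  have hqr0 : 0 < qr := by rw [hqr]; linarith
  have hqr1 : qr ≤ 1 := by rw [hqr]; linarith
  set q : unitInterval := ⟨qr, hqr0.le, hqr1⟩ with hq
  have hqval : (q : ℝ) = qr := rfl
  have hqpc : (q : ℝ) ≤ criticalProbI d := by rw [hqval, hqr]; linarith
  have hqlt : (q : ℝ) < criticalProbI d ∨ s L = 0 := by
    by_cases h0 : s L = 0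
    · exact Or.inr h0
    · left; rw [hqval, hqr]; have : 0 < s L := lt_of_le_of_ne hsL0 (Ne.symm h0); linarith
  -- the annulus crossing at `q_L` is small: envelope × subcritical arm decay
  have hsmall : (bondPercolation (zdGraph d) q).real (boxCrossing d L (4 * L)) < c85 / 4 := by
    rcases hqlt with hqlt | hs00
    · -- subcritical arm decay at `n = 3L − 1`
      have hn : 1 ≤ 3 * L - 1 := by omega
      have harmL := harm q (by rw [hqval, hqr]; linarith) hqlt (3 * L - 1) hn
      have hδq : (criticalProbI d : ℝ) - q = s L := by rw [hqval, hqr]; ring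
      rw [hδq, hsν L hL1'] at harmL
      -- `exp(−t_L (3L−1)/A) = exp(−d log L · (3L−1)/L) ≤ L^{−2d}`
      have hexp : Real.exp (-(t L * ((3 * L - 1 : ℕ) : ℝ)) / A) ≤ ((L : ℝ) ^ (2 * d))⁻¹ := by
        have h3L : (2 : ℝ) * L ≤ ((3 * L - 1 : ℕ) : ℝ) := by
          have : 3 * L - 1 = 2 * L + (L - 1) := by omega
          rw [this]; push_cast [show 1 ≤ L from hL1']; linarith
        have hlogL : 0 ≤ Real.log L := Real.log_nonneg (by linarith)
        have h1 : -(t L * ((3 * L - 1 : ℕ) : ℝ)) / A ≤ -(2 * d * Real.log L) := by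
          rw [ht]; dsimp only
          rw [div_le_iff₀ hA]
          have : A * d * Real.log L / L * ((3 * L - 1 : ℕ) : ℝ) ≥ A * d * Real.log L / L * (2 * L) :=
            mul_le_mul_of_nonneg_left h3L (div_nonneg (by positivity) hLpos.le)
          have h' : A * d * Real.log L / L * (2 * L) = 2 * d * Real.log L * A := by
            field_simp
          linarith
        calc Real.exp (-(t L * ((3 * L - 1 : ℕ) : ℝ)) / A) ≤ Real.exp (-(2 * d * Real.log L)) := Real.exp_le_exp.2 h1
          _ = ((L : ℝ) ^ (2 * d))⁻¹ := by
              rw [Real.exp_neg, show (2 * d : ℝ) * Real.log L = ((2 * d : ℕ) : ℝ) * Real.log L by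
                push_cast; ring, ← Real.log_pow, Real.exp_log (by positivity)]
      have henv := Rsw3.real_boxCrossing_le_card_mul_oneArmProb (d := d) q (show L < 4 * L by omega)
      have hsub : 4 * L - L - 1 = 3 * L - 1 := by omega
      rw [hsub] at henv
      have hbound : (bondPercolation (zdGraph d) q).real (boxCrossing d L (4 * L))
          ≤ (2 * (L : ℝ) + 1) ^ d * (A * ((3 * L - 1 : ℕ) : ℝ) ^ ((d : ℝ) - 1) * ((L : ℝ) ^ (2 * d))⁻¹) := by
        refine henv.trans (mul_le_mul_of_nonneg_left (harmL.trans ?_) (by positivity))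
        exact mul_le_mul_of_nonneg_left hexp (by positivity)
      -- `(2L+1)^d (3L−1)^{d−1} L^{−2d} ≤ 3^{2d−1}/L`
      have h2L : (2 * (L : ℝ) + 1) ^ d ≤ (3 : ℝ) ^ d * (L : ℝ) ^ d := by
        rw [← mul_pow]; exact pow_le_pow_left₀ (by positivity) (by linarith) d
      have h3Lr : ((3 * L - 1 : ℕ) : ℝ) ^ ((d : ℝ) - 1) ≤ (3 : ℝ) ^ (d - 1) * (L : ℝ) ^ (d - 1) := by
        have hcast : ((3 * L - 1 : ℕ) : ℝ) ≤ 3 * L := by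
          have : 3 * L - 1 ≤ 3 * L := Nat.sub_le _ _
          exact_mod_cast this
        have h0 : (0 : ℝ) ≤ ((3 * L - 1 : ℕ) : ℝ) := by positivity
        have hd1 : ((d : ℝ) - 1) = ((d - 1 : ℕ) : ℝ) := by push_cast [show 1 ≤ d by omega]; ring
        rw [hd1, Real.rpow_natCast, ← mul_pow]
        exact pow_le_pow_left₀ h0 hcast _
      have hprod : (2 * (L : ℝ) + 1) ^ d * (A * ((3 * L - 1 : ℕ) : ℝ) ^ ((d : ℝ) - 1) * ((L : ℝ) ^ (2 * d))⁻¹)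
          ≤ A * (3 : ℝ) ^ (2 * d - 1) / L := by
        have hL2d : (0 : ℝ) < (L : ℝ) ^ (2 * d) := by positivity
        calc (2 * (L : ℝ) + 1) ^ d * (A * ((3 * L - 1 : ℕ) : ℝ) ^ ((d : ℝ) - 1) * ((L : ℝ) ^ (2 * d))⁻¹)
            ≤ ((3 : ℝ) ^ d * (L : ℝ) ^ d) * (A * ((3 : ℝ) ^ (d - 1) * (L : ℝ) ^ (d - 1)) * ((L : ℝ) ^ (2 * d))⁻¹) := by
              refine mul_le_mul h2L (mul_le_mul_of_nonneg_right (mul_le_mul_of_nonneg_left h3Lr hA.le)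
                (by positivity)) (by positivity) (by positivity)
          _ = A * (3 : ℝ) ^ (2 * d - 1) / L := by
              have hd1 : d = (d - 1) + 1 := by omega
              have e1 : (3 : ℝ) ^ (2 * d - 1) = (3 : ℝ) ^ d * (3 : ℝ) ^ (d - 1) := by
                rw [← pow_add]; congr 1; omega
              have e2 : (L : ℝ) ^ (2 * d) = (L : ℝ) ^ d * (L : ℝ) ^ (d - 1) * L := by
                rw [← pow_add, ← pow_succ]; congr 1; omega
              rw [e1, e2]
              field_simp
      calc _ ≤ _ := hbound
        _ ≤ A * (3 : ℝ) ^ (2 * d - 1) / L := hprod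
        _ < c85 / 4 := h2
    · -- degenerate case `s_L = 0` (then `q = p_c`; impossible in fact, but then the window bound below is violated anyway)
      exfalso
      -- with `s L = 0` the right side of the window inequality is `0 < LHS`: use the window at `p_c` itself is not needed;
      -- instead note `t L = 0` forces `log L = 0`, contradicting `L ≥ 2`.
      have htL : t L = 0 := by rw [← hsν L hL1', hs00, Real.zero_rpow hν.ne']
      have hlog : Real.log L = 0 := by
        rw [ht] at htL; dsimp only at htL
        rw [div_eq_zero_iff] at htL
        rcases htL with h | h
        · rcases mul_eq_zero.1 h with h' | h'
          · rcases mul_eq_zero.1 h' with h'' | h''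
            · linarith
            · exact absurd h'' hd'.ne'
          · exact h'
        · linarith
      have : (L : ℝ) = 1 := by
        rcases Real.log_eq_zero.1 hlog with h | h | h
        · linarith
        · exact h
        · linarith
      linarith
  -- the window contrapositive at `(q_L, L)`
  have hwin := sq_mul_oneArm_gt_of_real_boxCrossing_lt hd q hqr0 hqpc hL1' hsmall
  have hδq : (criticalProbI d : ℝ) - q = s L := by rw [hqval, hqr]; ring
  rw [hδq] at hwin
  -- bound its right side by `K L^e (log L)^{2/ν}`
  have hθ : (bondPercolation (zdGraph d) (criticalProbI d)).real (siteToBoundary d L) ≤ C * (L : ℝ) ^ (-c) := hdec L hL1'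
  have hs2 : s L ^ 2 = (A * d) ^ (2 / ν) * ((L : ℝ) ^ (-(2 / ν)) * Real.log L ^ (2 / ν)) := by
    have hlogL : 0 ≤ Real.log L := Real.log_nonneg (by linarith)
    rw [hs]; dsimp only
    rw [← Real.rpow_natCast, ← Real.rpow_mul (ht0 L hL1')]
    rw [show (1 / ν * ((2 : ℕ) : ℝ)) = 2 / ν by push_cast; ring]
    rw [ht]; dsimp only
    rw [div_eq_mul_inv, Real.mul_rpow (by positivity) (by positivity), Real.mul_rpow (by positivity) hlogL,
      Real.inv_rpow hLpos.le, ← Real.rpow_neg hLpos.le]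
    ring
  have h8L : (8 * (L : ℝ) + 1) ^ d ≤ (9 : ℝ) ^ d * (L : ℝ) ^ d := by
    rw [← mul_pow]; exact pow_le_pow_left₀ (by positivity) (by linarith) d
  have hR : s L ^ 2 * (16 * d * (8 * (L : ℝ) + 1) ^ d
        * (bondPercolation (zdGraph d) (criticalProbI d)).real (siteToBoundary d L))
      ≤ K * ((L : ℝ) ^ e * Real.log L ^ (2 / ν)) := by
    have hθ0 : 0 ≤ (bondPercolation (zdGraph d) (criticalProbI d)).real (siteToBoundary d L) := measureReal_nonneg
    calc s L ^ 2 * (16 * d * (8 * (L : ℝ) + 1) ^ d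
          * (bondPercolation (zdGraph d) (criticalProbI d)).real (siteToBoundary d L))
        ≤ s L ^ 2 * (16 * d * ((9 : ℝ) ^ d * (L : ℝ) ^ d) * (C * (L : ℝ) ^ (-c))) := by
          refine mul_le_mul_of_nonneg_left ?_ (sq_nonneg _)
          exact mul_le_mul (mul_le_mul_of_nonneg_left h8L (by positivity)) hθ hθ0 (by positivity)
      _ = K * ((L : ℝ) ^ e * Real.log L ^ (2 / ν)) := by
          rw [hs2, hK, he]
          have hLd : (L : ℝ) ^ d = (L : ℝ) ^ (d : ℝ) := (Real.rpow_natCast _ _).symm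
          rw [hLd]
          have hexp : (L : ℝ) ^ ((d : ℝ) - c - 2 / ν) = (L : ℝ) ^ (-(2 / ν)) * (L : ℝ) ^ (d : ℝ) * (L : ℝ) ^ (-c) := by
            rw [← Real.rpow_add hLpos, ← Real.rpow_add hLpos]; congr 1; ring
          rw [hexp]; ring
  -- the left side is bounded below
  have hL' : c85 * (criticalProbI d / 2) * (1 - criticalProbI d) ≤ c85 * q * (1 - criticalProbI d) := by
    have h1 : (criticalProbI d : ℝ) / 2 ≤ q := by rw [hqval, hqr]; linarith
    have h2 : 0 ≤ 1 - (criticalProbI d : ℝ) := by linarith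
    exact mul_le_mul_of_nonneg_right (mul_le_mul_of_nonneg_left h1 hc85pos.le) h2
  linarith

/-- **COROLLARY: `c ≤ d − 2/ν`** — a one-arm exponent admissible together with a subcritical arm decay of exponent `ν` is at most
`d − 2/ν` (Dewan–Muirhead's `η̄₁ ≤ d − 2/ν`, kernel form on the lane's typed predicates).
[cite: DewanMuirhead2022, Thm. 1.10 (η̄₁ ≤ d − 2/ν)] -/
theorem oneArm_exponent_le_of_subcriticalArmDecay (hd : 2 ≤ d) {A ν δ₀ c C : ℝ} (hν : 0 < ν)
    (hA : 0 < A) (hδ₀ : 0 < δ₀) (harm : Quant.SubcriticalArmDecay d A ν δ₀)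
    (hdec : Quant.OneArmPolyDecayAtCritical d c C) : c ≤ d - 2 / ν := by
  have h := two_le_nu_mul_of_subcriticalArmDecay_of_oneArmDecay hd hν hA hδ₀ harm hdec
  have h1 : 2 / ν ≤ (d : ℝ) - c := by rw [div_le_iff₀ hν]; linarith
  linarith

/-- **COROLLARY: `ν ≥ 2/(d − c)`** — the correlation-length exponent admissible together with (T1)_c is at least `2/(d − c)`
(for `c < d`; note `c ≤ (d−1)/2 < d` always by `Quant.oneArmPolyDecayAtCritical_exponent_le`).
[cite: DewanMuirhead2022, Thm. 1.10 (η̄₁ ≤ d − 2/ν)] -/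
theorem nu_ge_of_subcriticalArmDecay_of_oneArmDecay (hd : 2 ≤ d) {A ν δ₀ c C : ℝ} (hν : 0 < ν)
    (hA : 0 < A) (hδ₀ : 0 < δ₀) (hcd : c < d) (harm : Quant.SubcriticalArmDecay d A ν δ₀)
    (hdec : Quant.OneArmPolyDecayAtCritical d c C) : 2 / ((d : ℝ) - c) ≤ ν := by
  have h := two_le_nu_mul_of_subcriticalArmDecay_of_oneArmDecay hd hν hA hδ₀ harm hdec
  rw [div_le_iff₀ (by linarith)]; linarith

/-- **`ℤ³`**: a one-arm exponent `c` admissible together with a subcritical arm decay of exponent `ν` on `ℤ³` satisfies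
`c ≤ 3 − 2/ν` (so `ν ≤ 0.88` would force `c ≤ 0.73`; `ν = 2/3` forces `c ≤ 0`; orientation only — both inputs are open).
[cite: DewanMuirhead2022, Thm. 1.10 (η̄₁ ≤ d − 2/ν)] -/
theorem oneArm_exponent_le_of_subcriticalArmDecay_three {A ν δ₀ c C : ℝ} (hν : 0 < ν) (hA : 0 < A) (hδ₀ : 0 < δ₀)
    (harm : Quant.SubcriticalArmDecay 3 A ν δ₀) (hdec : Quant.OneArmPolyDecayAtCritical 3 c C) :
    c ≤ 3 - 2 / ν := by
  have h := oneArm_exponent_le_of_subcriticalArmDecay (d := 3) (by norm_num) hν hA hδ₀ harm hdec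
  norm_num at h; exact h

end Summit.CriticalPhenomena.PercolationContinuityZ3.Theorems.CrossingRevealment

end
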